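import Summits.QuantumFields.YangMills.Theorems.AlphaInputsT3ACv3StepLowPrintOrbitOfUniqueMin
import Literature.MathematicalPhysics.QuantumFieldTheory.Balaban1983to89.T3DescentFibreTower
import HarnessLib

/-!
# `AlphaInputsT3ACMinimiserNestingOfUniqueMin` — PRINT'S COMPOSITION OF MINIMISERS «U_{k+1} = U_k(V^{(k)})» AT THE TRIVIAL HISTORY, MODULO THE GROUP (4), FROM ROW r1 +
# [Balaban1985Variational] THM 1's UNIQUENESS CLAUSE; hence THE DEEP FIBRE POINT OF (L1) LIES IN PRINT'S FAMILY `loPrintAC` ONE LEVEL DOWN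
# (cell `ym3-torus`, (α)-row #23 `fibre57LowOn`, the (E2) re-cut question «`χB_k(triv′) :=` print's χ_k^{min}» (w8-19936 g16 2026-08-30 15:53Z (5)); seat `ym3-torus-px20` g14,
# width copy of p1; sequel of ✓`AlphaInputsT3ACv3StepLowPrintOrbitOfUniqueMin`; `--supports stmt-QuantumFields-19936 --as helper`)

WHAT.  [Balaban1985UV3] p.268 L13–16 (the inductive step, trivial history): «We take the minimal configuration V^{(k)} of the functional A^η(U_k), which satisfies
… \bar{V^{(k)}} = V on Λ_{k+1}.  If we substitute it in U_k in place of V_k|Λ_k, we get the configuration U_{k+1}.»  For the RECORD's selected minimisers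
`U_j := ukAll q.X.Uk j` (rows r1–r3 only: existence in (8) + minimality over (6), NO composition clause) the level-`k` datum underneath `U_{k+1}(V)` is its `k`-fold (0.4)-average
`U₀ := (blockAvg ℰp)^k (U_{k+1}(V))` — the DEEP FIBRE POINT of ✓`AlphaInputsT3AC.PkgCoreRows.deepFibrePoint_of_rows` ((L1), seat g13) — and print's sentence becomes the ORBIT statement
`U_k(U₀) ∼ U_{k+1}(V)` under print's group (4) of level `k` (`u↓ = 1` on the level-`k` lattice).  THIS FILE derives it from row r1 (`q.minRows.1`, at levels `k+1` AND `k`) + the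
uniqueness letter `huniq` of ✓`…PrintOrbitOfUniqueMin` ([Balaban1985Variational] Thm 1 sentence 2 at the record's carriers) + the two γ-thresholds `ha₁ : θBal ≤ q.a₁`,
`ha₀L : L³·B₃·θBal ≤ q.a₀`, by print's own fibre-nesting argument: `U_{k+1}(V)` lies in the level-`k` fibre of `U₀` (definition of `U₀`, lit ✓`T3DescentFibreTower`), is regular there at
radius `B₃ε₁(k)` (its level-`(k+1)` radius `B₃ε₁(k+1)` rescaled: `ε₁(k+1)·L⁻² ≤ ε₁(k)`, lit ✓`sqrt_inv_mul_θBal_le_succ`), and minimises the Wilson action over the level-`k` space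
(8)(U₀) because that space sits inside the level-`(k+1)` space (6)(L³B₃ε₁(k))(V) over which `U_{k+1}(V)` minimises (r1 at `ε₀ := L³B₃ε₁(k) ≤ a₀`); so `U_{k+1}(V)` and `U_k(U₀)` are two
minimal configurations of (8)(U₀) at level `k`, and Thm 1's uniqueness clause puts them on ONE orbit of (4).
* §1 (Literature currency, any member) `regPr_succ_height_of_regPr` ∕ `regPr_of_regPr_succ_height` (both clauses of [7] (2) between consecutive comparison heights: radius `·L⁻²`
  up, `·L³` down), `regFibrePr_descendTo_succ_subset` ((8)-type space of the one-step-coarser datum ⊆ (6)-type space of the finer datum, lit ✓`mem_fibre_trans` ∕ ✓`descendTo_descendTo`).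
* §2 (record, heights `m`, `m+1`) ★★ `sameOrbit_ukAll_iterAvg_aux` — `T3Thm1Carrier.SameOrbit F (m+1) K _ (U_k(U₀)) (U_{k+1}(V))`, `k = K − (m+1)`; (levels) ★★ `ukAll_iterAvg_mem_orbit` —
  `∃ w, U_k(U₀) = U_{k+1}(V)^w`, every `1 ≤ k`, `k + 1 ≤ K` (`k = 0`: `U_0 = id`, `U₀ = U_1(V)`, trivial — `ukAll_iterAvg_mem_orbit_zero`).
* §3 ★★★ `iterAvg_ukAll_mem_loPrintAC` — for `V ∈ loPrintAC (k+1)` (print's family: (4)-window ∧ «|U_{k+1}(V)(∂p) − 1| < ε₁(k+1)η²») and `U₀` in the level-`k` (4)-window (the conjunct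
  `χB_k(triv′)(U₀) ≠ 0` of (L1), ✓`plaqSmall_of_chiB_triv_ne_zero`), `U₀ ∈ loPrintAC k`: `|U_k(U₀)(∂p) − 1| = |U_{k+1}(V)(∂p) − 1| < ε₁(k+1)L^{−2(k+1)} ≤ ε₁(k)L^{−2k}` — THE EXTRA CONJUNCT
  the (E2) re-cut «(58)-floor := print's χ_k^{min}» would demand of the deep fibre point, FROM r1 + r1′, NO NEW ESTIMATE (answer to w8-19936 g16's (5): «NAME the row it needs» = r1′).

HONEST SCOPE.  [folklore] bookkeeping of rows r1 (two levels), of the fibre tower and of a displayed printed clause (`huniq` is a HYPOTHESIS, never asserted; print's proof = [7] Sect. E);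
def-free; nothing of #23's pins, `hdom`, (47)∕(57), the (α) data rows (0∕23), (O‴χₛ), `HistoryTailL` (19936), EX, LOWB∘ or `YM3TorusSU2` is proved (rung R3 = SU(2) YM₃ on T³, a RECORD rung:
NOT d = 4, NOT infinite volume, NOT a mass gap, NOT Clay; the Yang–Mills mass gap is NOT proved).  L-floor: none (`L ≥ 2` from the family).
References: T. Bałaban, Commun. Math. Phys. **102** (1985) 255–275 [Balaban1985UV3] ((42) p.266, (47) p.267, p.268 L13–16, (50)–(52) p.268); **102** (1985) 277–309
[Balaban1985Variational] ((2)–(8) p.278, Thm 1 p.279, (181) p.307); **109** (1987) 249–301 [Balaban1987RG1] ((0.11) p.253, (0.21) p.256).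
-/

set_option autoImplicit false

noncomputable section

namespace Summit.QuantumFields.YangMills.Theorems

open MeasureTheory Literature.MathematicalPhysics.QuantumFieldTheory.Balaban1983to89
open Literature.MathematicalPhysics.QuantumFieldTheory.Balaban1983to89.GaugeField (gaugeAct)
open Literature.MathematicalPhysics.QuantumFieldTheory.Balaban1983to89.T3ContinuumYM3Torus
open Literature.MathematicalPhysics.QuantumFieldTheory.Balaban1983to89.T3UnitLawDensityEML (ℰp)
open Literature.MathematicalPhysics.QuantumFieldTheory.Balaban1983to89.T3UnitScaleTilt (θBal)
open Literature.MathematicalPhysics.QuantumFieldTheory.Balaban1983to89.T3LevelShift (fieldShift siteShift)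
open Literature.MathematicalPhysics.QuantumFieldTheory.Balaban1983to89.T3TiltDescent (descendTo)
open Literature.MathematicalPhysics.QuantumFieldTheory.Balaban1983to89.T3ConstrainedMinimiser (fibre)
open Literature.MathematicalPhysics.QuantumFieldTheory.Balaban1983to89.T3RegularMinimiser (regThreshold)
open Literature.MathematicalPhysics.QuantumFieldTheory.Balaban1983to89.T3PrintedRegularMinimiser (RegPr DivSmall regFibrePr mem_regFibrePr_iff)
open Literature.MathematicalPhysics.QuantumFieldTheory.Balaban1983to89.T3PrintedMinimiserExistence (plaqSmall_of_le)
open Literature.MathematicalPhysics.QuantumFieldTheory.Balaban1983to89.T3DescentFibreTower (mem_fibre_trans descendTo_descendTo mem_fibre_iff)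
open Literature.MathematicalPhysics.QuantumFieldTheory.Balaban1983to89.T3Thm1Carrier (varProblem3 SameOrbit)
open Literature.MathematicalPhysics.QuantumFieldTheory.Balaban1985CMP102 Literature.MathematicalPhysics.QuantumFieldTheory.Balaban1985CMP102.Setting
open Summit.QuantumFields.Balaban3D.Carriers
open Summit.QuantumFields.Balaban3D.Proofs.Primitives
open Summit.QuantumFields.Balaban3D.Proofs.TowerAC Summit.QuantumFields.Balaban3D.Proofs.StandardAC Summit.QuantumFields.Balaban3D.Proofs.InputsAC

/-! ## §0 Two γ∕L inequalities between consecutive smallness parameters `θBal(i) = ε₁(K−i)` -/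

namespace AlphaInputsT3AC

/-- **`θ(i)·L⁻² ≤ θ(i+1)`** (`ε₁(k+1)·L⁻² ≤ ε₁(k)`): from lit ✓`sqrt_inv_mul_θBal_le_succ` (`√(L⁻¹)·θ(i) ≤ θ(i+1)`) and `L⁻² ≤ √(L⁻¹)` (`L ≥ 1`). [cite: Balaban1985UV3, (3) p.256 and (7) p.257] -/
theorem θBal_mul_inv_sq_le_succ {L : ℕ} (hL : 1 ≤ L) {γ b₀ p₀ : ℝ} (hγ : 0 < γ) (hγ1 : γ ≤ 1) (hb : 0 < b₀) (hp : 0 ≤ p₀) (i : ℕ) :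
    θBal L γ b₀ p₀ i * ((L : ℝ)⁻¹) ^ 2 ≤ θBal L γ b₀ p₀ (i + 1) := by
  have hL1r : (1 : ℝ) ≤ L := by exact_mod_cast hL
  have hx0 : 0 ≤ ((L : ℝ)⁻¹) := inv_nonneg.mpr (by positivity)
  have hx1 : ((L : ℝ)⁻¹) ≤ 1 := inv_le_one_of_one_le₀ hL1r
  have hsqrt : ((L : ℝ)⁻¹) ^ 2 ≤ Real.sqrt ((L : ℝ)⁻¹) :=
    calc ((L : ℝ)⁻¹) ^ 2 ≤ ((L : ℝ)⁻¹) := pow_le_of_le_one hx0 hx1 two_ne_zero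
      _ ≤ Real.sqrt ((L : ℝ)⁻¹) := Real.le_sqrt_of_sq_le (by nlinarith)
  have hθ : 0 ≤ θBal L γ b₀ p₀ i := (T3MinimiserStabilityReduction.θBal_pos hL hγ hγ1 hb p₀ i).le
  calc θBal L γ b₀ p₀ i * ((L : ℝ)⁻¹) ^ 2 ≤ θBal L γ b₀ p₀ i * Real.sqrt ((L : ℝ)⁻¹) := mul_le_mul_of_nonneg_left hsqrt hθ
    _ = Real.sqrt ((L : ℝ)⁻¹) * θBal L γ b₀ p₀ i := mul_comm _ _
    _ ≤ θBal L γ b₀ p₀ (i + 1) := T3SmallLiftHistory.sqrt_inv_mul_θBal_le_succ hL hγ hγ1 hb.le hp i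

/-- **`θ(i) ≤ L³·θ(i+1)`** (`ε₁(k+1) ≤ L³·ε₁(k)`): from `√(L⁻¹)·θ(i) ≤ θ(i+1)` and `1 ≤ √(L⁻¹)·L³` (`L ≥ 1`). [cite: Balaban1985UV3, (3) p.256 and (7) p.257] -/
theorem θBal_le_cube_mul_succ {L : ℕ} (hL : 1 ≤ L) {γ b₀ p₀ : ℝ} (hγ : 0 < γ) (hγ1 : γ ≤ 1) (hb : 0 < b₀) (hp : 0 ≤ p₀) (i : ℕ) :
    θBal L γ b₀ p₀ i ≤ (L : ℝ) ^ 3 * θBal L γ b₀ p₀ (i + 1) := by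
  have hL1r : (1 : ℝ) ≤ L := by exact_mod_cast hL
  have hstep := T3SmallLiftHistory.sqrt_inv_mul_θBal_le_succ hL hγ hγ1 hb.le hp i
  have hθ : 0 ≤ θBal L γ b₀ p₀ i := (T3MinimiserStabilityReduction.θBal_pos hL hγ hγ1 hb p₀ i).le
  have hsq1 : 1 ≤ Real.sqrt ((L : ℝ)⁻¹) * (L : ℝ) ^ 3 := by
    have hs : Real.sqrt ((L : ℝ)⁻¹) = (Real.sqrt (L : ℝ))⁻¹ := Real.sqrt_inv _
    have hsL : Real.sqrt (L : ℝ) ≤ (L : ℝ) := by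
      rw [Real.sqrt_le_left (by positivity)]; nlinarith
    have hspos : 0 < Real.sqrt (L : ℝ) := Real.sqrt_pos.2 (by positivity)
    have h1 : 0 ≤ ((L : ℝ) - 1) * (L : ℝ) := by nlinarith
    have hLL : (L : ℝ) ≤ (L : ℝ) ^ 3 := by nlinarith [mul_nonneg h1 (by linarith : (0 : ℝ) ≤ (L : ℝ) + 1)]
    rw [hs, ← div_eq_inv_mul, le_div_iff₀ hspos]
    linarith [hsL, hLL]
  calc θBal L γ b₀ p₀ i ≤ (Real.sqrt ((L : ℝ)⁻¹) * (L : ℝ) ^ 3) * θBal L γ b₀ p₀ i := le_mul_of_one_le_left hθ hsq1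
    _ = (L : ℝ) ^ 3 * (Real.sqrt ((L : ℝ)⁻¹) * θBal L γ b₀ p₀ i) := by ring
    _ ≤ (L : ℝ) ^ 3 * θBal L γ b₀ p₀ (i + 1) := mul_le_mul_of_nonneg_left hstep (by positivity)

end AlphaInputsT3AC

/-! ## §1 Both clauses of [7] (2) between consecutive comparison heights; the coarser datum's space inside the finer datum's -/

namespace AlphaInputsT3AC

/-- `(L⁻¹)^{a(K−m)} = (L⁻¹)^a · (L⁻¹)^{a(K−(m+1))}` for `m + 1 ≤ K` (exponent bookkeeping). [folklore] -/
theorem inv_pow_height_succ (F : T3Family) {m K : ℕ} (hm : m + 1 ≤ K) (a : ℕ) :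
    ((F.L : ℝ)⁻¹) ^ (a * (K - m)) = ((F.L : ℝ)⁻¹) ^ a * ((F.L : ℝ)⁻¹) ^ (a * (K - (m + 1))) := by
  rw [← pow_add]; congr 1
  have : K - m = K - (m + 1) + 1 := by omega
  rw [this]; ring

/-- **[7] (2) ONE HEIGHT UP** (finer comparison lattice `m ↦ m + 1`, i.e. level `k + 1 ↦ k` of run `K`): a configuration in `𝔘_{k+1}(ε)` lies in `𝔘_k(ε′)` as soon as `ε·L⁻² ≤ ε′` (`ε ≥ 0`) —
plaquette clause `ε·L^{−2(k+1)} ≤ ε′·L^{−2k}`, divergence clause `ε·L^{−3(k+1)} ≤ ε′·L^{−3k}`. [cite: Balaban1985Variational, (2) p.278; Balaban1985RegularSpaces, (1.7)+(1.9) p.77] -/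
theorem regPr_succ_height_of_regPr (F : T3Family) {m K : ℕ} (hm : m + 1 ≤ K) {ε ε' : ℝ} (hε : 0 ≤ ε) (hεε' : ε * ((F.L : ℝ)⁻¹) ^ 2 ≤ ε')
    {U : GaugeField (F.P K) 0 (Matrix.specialUnitaryGroup (Fin 2) ℂ)} (hU : RegPr F m K ε U) : RegPr F (m + 1) K ε' U := by
  have hLinv : 0 ≤ ((F.L : ℝ)⁻¹) := inv_nonneg.mpr (Nat.cast_nonneg _)
  have hLinv1 : ((F.L : ℝ)⁻¹) ≤ 1 := inv_le_one_of_one_le₀ (by have := F.hL.2; exact_mod_cast (by omega : 1 ≤ F.L))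
  refine ⟨plaqSmall_of_le ?_ hU.1, fun b => (hU.2 b).trans_le ?_⟩
  · show ε * ((F.L : ℝ)⁻¹) ^ (2 * (K - m)) ≤ ε' * ((F.L : ℝ)⁻¹) ^ (2 * (K - (m + 1)))
    rw [inv_pow_height_succ F hm 2, ← mul_assoc]
    exact mul_le_mul_of_nonneg_right hεε' (pow_nonneg hLinv _)
  · rw [inv_pow_height_succ F hm 3, ← mul_assoc]
    refine mul_le_mul_of_nonneg_right ?_ (pow_nonneg hLinv _)
    calc ε * ((F.L : ℝ)⁻¹) ^ 3 ≤ ε * ((F.L : ℝ)⁻¹) ^ 2 :=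
          mul_le_mul_of_nonneg_left (pow_le_pow_of_le_one hLinv hLinv1 (by norm_num)) hε
      _ ≤ ε' := hεε'

/-- **[7] (2) ONE HEIGHT DOWN** (coarser comparison lattice `m + 1 ↦ m`, i.e. level `k ↦ k + 1`): a configuration in `𝔘_k(ε)` lies in `𝔘_{k+1}(ε′)` as soon as `L³·ε ≤ ε′` (`ε ≥ 0`).
[cite: Balaban1985Variational, (2) p.278; Balaban1985RegularSpaces, (1.7)+(1.9) p.77] -/
theorem regPr_of_regPr_succ_height (F : T3Family) {m K : ℕ} (hm : m + 1 ≤ K) {ε ε' : ℝ} (hε : 0 ≤ ε) (hεε' : (F.L : ℝ) ^ 3 * ε ≤ ε')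
    {U : GaugeField (F.P K) 0 (Matrix.specialUnitaryGroup (Fin 2) ℂ)} (hU : RegPr F (m + 1) K ε U) : RegPr F m K ε' U := by
  have hL1 : (1 : ℝ) ≤ F.L := by have := F.hL.2; exact_mod_cast (by omega : 1 ≤ F.L)
  have hLpos : (0 : ℝ) < F.L := by linarith
  have hLinv : 0 ≤ ((F.L : ℝ)⁻¹) := inv_nonneg.mpr hLpos.le
  -- `ε ≤ ε′·L⁻³ ≤ ε′·L⁻²`
  have hε' : 0 ≤ ε' := le_trans (by positivity) hεε'
  have h3 : ε ≤ ε' * ((F.L : ℝ)⁻¹) ^ 3 := by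
    rw [inv_pow, ← div_eq_mul_inv, le_div_iff₀ (by positivity)]; linarith [hεε']
  have h2 : ε ≤ ε' * ((F.L : ℝ)⁻¹) ^ 2 := by
    refine h3.trans (mul_le_mul_of_nonneg_left ?_ hε')
    exact pow_le_pow_of_le_one hLinv (inv_le_one_of_one_le₀ hL1) (by norm_num)
  refine ⟨plaqSmall_of_le ?_ hU.1, fun b => (hU.2 b).trans_le ?_⟩
  · show ε * ((F.L : ℝ)⁻¹) ^ (2 * (K - (m + 1))) ≤ ε' * ((F.L : ℝ)⁻¹) ^ (2 * (K - m))
    rw [inv_pow_height_succ F hm 2, ← mul_assoc]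
    exact mul_le_mul_of_nonneg_right h2 (pow_nonneg hLinv _)
  · rw [inv_pow_height_succ F hm 3, ← mul_assoc]
    exact mul_le_mul_of_nonneg_right h3 (pow_nonneg hLinv _)

/-- **THE (8)-TYPE SPACE OF THE ONE-STEP-COARSER DATUM SITS INSIDE THE (6)-TYPE SPACE OF THE FINER DATUM**: for a configuration `U′` of run `K`, its level-`k` space over its own `k`-fold
average, `𝔘_k(ε) ∩ 𝔅_k(D_{m+1,K}U′)`, is contained in `𝔘_{k+1}(ε′) ∩ 𝔅_{k+1}(D_{m,K}U′)` when `L³ε ≤ ε′` (fibres nest by lit ✓`descendTo_descendTo` ∕ ✓`mem_fibre_trans`; regularity by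
`regPr_of_regPr_succ_height`). [cite: Balaban1987RG1, (0.11) p.253; Balaban1985Variational, (6) p.278] -/
theorem regFibrePr_descendTo_succ_subset (F : T3Family) {m K : ℕ} (hm : m + 1 ≤ K) {ε ε' : ℝ} (hε : 0 ≤ ε) (hεε' : (F.L : ℝ) ^ 3 * ε ≤ ε')
    (U' : GaugeField (F.P K) 0 (Matrix.specialUnitaryGroup (Fin 2) ℂ)) :
    regFibrePr F (m + 1) K hm ε (descendTo F ℰp (m + 1) K hm U') ⊆ regFibrePr F m K (Nat.le_of_succ_le hm) ε' (descendTo F ℰp m K (Nat.le_of_succ_le hm) U') := by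
  intro W hW
  obtain ⟨hWf, hWr⟩ := (mem_regFibrePr_iff F).mp hW
  refine (mem_regFibrePr_iff F).mpr ⟨?_, regPr_of_regPr_succ_height F hm hε hεε' hWr⟩
  have hnest : descendTo F ℰp (m + 1) K hm U' ∈ fibre F ℰp m (m + 1) (Nat.le_succ m) (descendTo F ℰp m K (Nat.le_of_succ_le hm) U') := by
    rw [mem_fibre_iff, descendTo_descendTo]
  exact mem_fibre_trans F ℰp (Nat.le_succ m) hm hWf hnest

end AlphaInputsT3AC

/-! ## §2 At the T³ rows record: `U_k((blockAvg)^k U_{k+1}(V)) ∼ U_{k+1}(V)` under the group (4) -/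

namespace AlphaInputsT3AC.PkgCoreRows

variable {F : T3Family} {𝔠 : AlphaConsts F.L (suGroupModel 2).N} {γ : ℝ} {hγ : 0 < γ} {hγ1 : γ ≤ (min 𝔠.gamma0 1) ^ 2} {K : ℕ}
  (q : AlphaInputsT3AC.PkgCoreRows F 𝔠 γ hγ hγ1 K)

/-- ★★ **PRINT'S COMPOSITION OF MINIMISERS MODULO (4), heights form** (`m + 1 < K`; level `k + 1 = K − m` datum `V`, level `k = K − (m+1)` datum `U₀ := (blockAvg ℰp)^k U_{k+1}(V)`): if
`V` is in the level-`(k+1)` (4)-window and `U₀` in the level-`k` (4)-window, then `U_k(U₀)` and `U_{k+1}(V)` lie on ONE orbit of print's group (4) of level `k` —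
`T3Thm1Carrier.SameOrbit F (m+1) K _ (U_k(U₀)) (U_{k+1}(V))`.  From row r1 at both levels, `ha₁`, `ha₀L : L³B₃θBal ≤ a₀`, and `huniq` (Thm 1 sentence 2) at level `k`.
[cite: Balaban1985UV3, p.268 L13–16 + (42) p.266; Balaban1985Variational, Thm 1 (8) p.279; Balaban1987RG1, (0.11) p.253] -/
theorem sameOrbit_ukAll_iterAvg_aux (ha₁ : ∀ i, θBal F.L γ 𝔠.b₀ 𝔠.p₀ i ≤ q.a₁)
    (ha₀L : ∀ i, (F.L : ℝ) ^ 3 * (𝔠.B₃ * θBal F.L γ 𝔠.b₀ 𝔠.p₀ i) ≤ q.a₀)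
    (huniq : ∀ (n : ℕ) (hnK : n < K) (ε₁ ε₀ : ℝ), 0 < ε₁ → ε₁ ≤ q.a₁ → 𝔠.B₃ * ε₁ ≤ ε₀ → ε₀ ≤ q.a₀ →
      ∀ V : GaugeField (F.P n) 0 (Matrix.specialUnitaryGroup (Fin 2) ℂ), PlaqSmall ε₁ V →
        ∀ U : GaugeField (F.P K) 0 (Matrix.specialUnitaryGroup (Fin 2) ℂ),
          (varProblem3 F n K hnK.le).OnMinimalOrbit (𝔠.B₃ * ε₁) V U → (varProblem3 F n K hnK.le).UniqueCriticalOrbit ε₀ V U)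
    (m : ℕ) (hm : m + 1 < K) (V : GaugeField (F.P K) (K - m) (Matrix.specialUnitaryGroup (Fin 2) ℂ))
    (hV : PlaqSmall (eps1Of (T3Scales F γ hγ (hγ1.trans (sq_min_one_le _ 𝔠.gamma0_pos)) K) 𝔠.lane.carrier (K - m)) V)
    (hU₀ : PlaqSmall (eps1Of (T3Scales F γ hγ (hγ1.trans (sq_min_one_le _ 𝔠.gamma0_pos)) K) 𝔠.lane.carrier (K - (m + 1)))
      (Averaging.iter (fun i => BlockAveraging.blockAvg (P := F.P K) (j := i) ℰp) (K - (m + 1)) (ukAll q.X.Uk (K - m) V))) :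
    SameOrbit F (m + 1) K hm.le
      (ukAll q.X.Uk (K - (m + 1)) (Averaging.iter (fun i => BlockAveraging.blockAvg (P := F.P K) (j := i) ℰp) (K - (m + 1)) (ukAll q.X.Uk (K - m) V)))
      (ukAll q.X.Uk (K - m) V) := by
  have hmK : m < K := by omega
  -- the two smallness parameters `θ′ = ε₁(k+1) = θBal(m)`, `θ = ε₁(k) = θBal(m+1)` and the thresholds
  have hθ' : 0 < θBal F.L γ 𝔠.b₀ 𝔠.p₀ m := by
    have := q.θBal_pos (K - m) (Nat.sub_le _ _); rwa [Nat.sub_sub_self hmK.le] at this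
  have hθ : 0 < θBal F.L γ 𝔠.b₀ 𝔠.p₀ (m + 1) := by
    have := q.θBal_pos (K - (m + 1)) (Nat.sub_le _ _); rwa [Nat.sub_sub_self hm.le] at this
  have heps' : eps1Of (T3Scales F γ hγ (hγ1.trans (sq_min_one_le _ 𝔠.gamma0_pos)) K) 𝔠.lane.carrier (K - m) = θBal F.L γ 𝔠.b₀ 𝔠.p₀ m := by
    have := q.eps1_eq (K - m) (Nat.sub_le _ _); rwa [Nat.sub_sub_self hmK.le] at this
  have heps : eps1Of (T3Scales F γ hγ (hγ1.trans (sq_min_one_le _ 𝔠.gamma0_pos)) K) 𝔠.lane.carrier (K - (m + 1)) = θBal F.L γ 𝔠.b₀ 𝔠.p₀ (m + 1) := by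
    have := q.eps1_eq (K - (m + 1)) (Nat.sub_le _ _); rwa [Nat.sub_sub_self hm.le] at this
  rw [heps'] at hV
  rw [heps] at hU₀
  have hL1 : 1 ≤ F.L := by have := F.hL.2; omega
  have hγ1' : γ ≤ 1 := hγ1.trans (sq_min_one_le _ 𝔠.gamma0_pos)
  -- `θ′·L⁻² ≤ θ`, `θ′ ≤ L³·θ` (§0)
  have hup : 𝔠.B₃ * θBal F.L γ 𝔠.b₀ 𝔠.p₀ m * ((F.L : ℝ)⁻¹) ^ 2 ≤ 𝔠.B₃ * θBal F.L γ 𝔠.b₀ 𝔠.p₀ (m + 1) := by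
    rw [mul_assoc]
    exact mul_le_mul_of_nonneg_left (AlphaInputsT3AC.θBal_mul_inv_sq_le_succ hL1 hγ hγ1' 𝔠.b₀_pos 𝔠.p₀_pos.le m) 𝔠.B₃_pos.le
  have hdown : 𝔠.B₃ * θBal F.L γ 𝔠.b₀ 𝔠.p₀ m ≤ (F.L : ℝ) ^ 3 * (𝔠.B₃ * θBal F.L γ 𝔠.b₀ 𝔠.p₀ (m + 1)) :=
    calc 𝔠.B₃ * θBal F.L γ 𝔠.b₀ 𝔠.p₀ m ≤ 𝔠.B₃ * ((F.L : ℝ) ^ 3 * θBal F.L γ 𝔠.b₀ 𝔠.p₀ (m + 1)) :=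
          mul_le_mul_of_nonneg_left (AlphaInputsT3AC.θBal_le_cube_mul_succ hL1 hγ hγ1' 𝔠.b₀_pos 𝔠.p₀_pos.le m) 𝔠.B₃_pos.le
      _ = (F.L : ℝ) ^ 3 * (𝔠.B₃ * θBal F.L γ 𝔠.b₀ 𝔠.p₀ (m + 1)) := by ring
  have hθ'a : θBal F.L γ 𝔠.b₀ 𝔠.p₀ m ≤ q.a₁ := ha₁ m
  have hθa : θBal F.L γ 𝔠.b₀ 𝔠.p₀ (m + 1) ≤ q.a₁ := ha₁ (m + 1)
  have hhi : 𝔠.B₃ * θBal F.L γ 𝔠.b₀ 𝔠.p₀ (m + 1) ≤ q.a₀ :=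
    (mul_le_mul_of_nonneg_left hθa 𝔠.B₃_pos.le).trans q.consts_ok.2.2
  have hL3 : (F.L : ℝ) ^ 3 * (𝔠.B₃ * θBal F.L γ 𝔠.b₀ 𝔠.p₀ (m + 1)) ≤ q.a₀ := ha₀L (m + 1)
  have hBθ : 0 ≤ 𝔠.B₃ * θBal F.L γ 𝔠.b₀ 𝔠.p₀ (m + 1) := (mul_pos 𝔠.B₃_pos hθ).le
  have hBθ' : 0 ≤ 𝔠.B₃ * θBal F.L γ 𝔠.b₀ 𝔠.p₀ m := (mul_pos 𝔠.B₃_pos hθ').le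
  -- the finest minimiser `U′ := U_{k+1}(V)` and the deep datum `U₀`
  rw [← q.X.UkH_triv (K - m) V] at hU₀ ⊢
  -- shift `V` to height `m` (opaque atom `V₀`) and apply row r1 at height `m` with `ε₁ := θ′`, `ε₀ := L³B₃θ`
  have hshm : (F.PP F.m K).sitesPerDir (K - m) = (F.PP F.m m).sitesPerDir 0 :=
    F.sitesPerDir_eq (m := F.m) (K := K) (j := K - m) (m' := F.m) (K' := m) (j' := 0) (by omega)
  obtain ⟨V₀, hV₀def⟩ : ∃ V₀ : GaugeField (F.P m) 0 (Matrix.specialUnitaryGroup (Fin 2) ℂ), V₀ = fieldShift hshm.symm V := ⟨_, rfl⟩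
  have hVK : fieldShift hshm V₀ = V := by rw [hV₀def]; exact T3LevelShift.fieldShift_symm_fieldShift hshm V
  have hV₀ : PlaqSmall (θBal F.L γ 𝔠.b₀ 𝔠.p₀ m) V₀ := by
    rw [hV₀def]; exact (T3CruxEstimates.plaqSmall_fieldShift F hshm.symm _ V).mpr hV
  have hr1' := q.minRows.1 m hmK (θBal F.L γ 𝔠.b₀ 𝔠.p₀ m) ((F.L : ℝ) ^ 3 * (𝔠.B₃ * θBal F.L γ 𝔠.b₀ 𝔠.p₀ (m + 1))) hθ' hθ'a hdown hL3 V₀ hV₀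
  rw [hVK] at hr1'
  -- `hr1' : U′ ∈ regFibrePr F m K _ (B₃θ′) V₀ ∧ IsMinOn A (regFibrePr F m K _ (L³B₃θ) V₀) U′`, `U′ = q.UkH (K-m) triv V`
  obtain ⟨hU'8, hU'min⟩ := hr1'
  -- `V₀ = D_{m,K} U′` and `U₀′ := D_{m+1,K} U′` is the deep datum read at height `m+1`
  have hV₀desc : descendTo F ℰp m K hmK.le (q.UkH (K - m) (Hist.triv (F.P K) (K - m)) V) = V₀ := ((mem_regFibrePr_iff F).mp hU'8).1
  have hshm1 : (F.PP F.m K).sitesPerDir (K - (m + 1)) = (F.PP F.m (m + 1)).sitesPerDir 0 :=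
    F.sitesPerDir_eq (m := F.m) (K := K) (j := K - (m + 1)) (m' := F.m) (K' := m + 1) (j' := 0) (by omega)
  obtain ⟨U₀', hU₀'def⟩ : ∃ U₀' : GaugeField (F.P (m + 1)) 0 (Matrix.specialUnitaryGroup (Fin 2) ℂ),
      U₀' = descendTo F ℰp (m + 1) K hm.le (q.UkH (K - m) (Hist.triv (F.P K) (K - m)) V) := ⟨_, rfl⟩
  have hU₀K : fieldShift hshm1 U₀' =
      Averaging.iter (fun i => BlockAveraging.blockAvg (P := F.P K) (j := i) ℰp) (K - (m + 1)) (q.X.UkH (K - m) (Hist.triv (F.P K) (K - m)) V) := by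
    rw [hU₀'def]; exact T3LevelShift.fieldShift_symm_fieldShift hshm1 _
  have hU₀'small : PlaqSmall (θBal F.L γ 𝔠.b₀ 𝔠.p₀ (m + 1)) U₀' := by
    refine (T3CruxEstimates.plaqSmall_fieldShift F hshm1 _ U₀').mp ?_
    rw [hU₀K]; exact hU₀
  -- row r1 at height `m+1` with `ε₁ := θ`, `ε₀ := B₃θ`: `Umin := U_k(U₀)` is on a minimal orbit of (8)(U₀′)
  have hr1 := q.minRows.1 (m + 1) hm (θBal F.L γ 𝔠.b₀ 𝔠.p₀ (m + 1)) (𝔠.B₃ * θBal F.L γ 𝔠.b₀ 𝔠.p₀ (m + 1)) hθ hθa le_rfl hhi U₀' hU₀'small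
  rw [hU₀K] at hr1
  -- `U′` is ALSO on a minimal orbit of (8)(U₀′) at height `m+1`: membership by the fibre tower + [7] (2) one height up, minimality by the inclusion into (6)(L³B₃θ)(V₀)
  have hU'mem : q.UkH (K - m) (Hist.triv (F.P K) (K - m)) V ∈ regFibrePr F (m + 1) K hm.le (𝔠.B₃ * θBal F.L γ 𝔠.b₀ 𝔠.p₀ (m + 1)) U₀' := by
    refine (mem_regFibrePr_iff F).mpr ⟨?_, AlphaInputsT3AC.regPr_succ_height_of_regPr F hm.le hBθ' hup ((mem_regFibrePr_iff F).mp hU'8).2⟩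
    rw [mem_fibre_iff, hU₀'def]
  have hsub : regFibrePr F (m + 1) K hm.le (𝔠.B₃ * θBal F.L γ 𝔠.b₀ 𝔠.p₀ (m + 1)) U₀' ⊆
      regFibrePr F m K hmK.le ((F.L : ℝ) ^ 3 * (𝔠.B₃ * θBal F.L γ 𝔠.b₀ 𝔠.p₀ (m + 1))) V₀ := by
    rw [hU₀'def, ← hV₀desc]
    exact AlphaInputsT3AC.regFibrePr_descendTo_succ_subset F hm.le hBθ le_rfl _
  have hU'min8 : IsMinOn (fun W : GaugeField (F.P K) 0 (Matrix.specialUnitaryGroup (Fin 2) ℂ) => wilsonAction4 W)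
      (regFibrePr F (m + 1) K hm.le (𝔠.B₃ * θBal F.L γ 𝔠.b₀ 𝔠.p₀ (m + 1)) U₀') (q.UkH (K - m) (Hist.triv (F.P K) (K - m)) V) :=
    hU'min.on_subset hsub
  -- Thm 1's uniqueness clause at height `m+1`, `ε₁ := θ`, `ε₀ := B₃θ`, datum `U₀′`, minimal configuration `Umin`
  obtain ⟨-, hUq⟩ := huniq (m + 1) hm (θBal F.L γ 𝔠.b₀ 𝔠.p₀ (m + 1)) (𝔠.B₃ * θBal F.L γ 𝔠.b₀ 𝔠.p₀ (m + 1)) hθ hθa le_rfl hhi U₀' hU₀'small _ hr1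
  have hso := hUq _ hU'mem hU'min8
  rw [← q.X.UkH_triv (K - (m + 1))]
  exact hso

/-- The same, as a bare orbit statement «`U_{k+1}(V) = U_k(U₀)^w` for some fine gauge transformation `w`» (heights form; the `w↓ = 1` clause of the group (4) dropped).
[cite: Balaban1985UV3, p.268 L13–16; Balaban1985Variational, Thm 1 (8) p.279] -/
theorem exists_ukAll_eq_gaugeAct_ukAll_iterAvg_aux (ha₁ : ∀ i, θBal F.L γ 𝔠.b₀ 𝔠.p₀ i ≤ q.a₁)
    (ha₀L : ∀ i, (F.L : ℝ) ^ 3 * (𝔠.B₃ * θBal F.L γ 𝔠.b₀ 𝔠.p₀ i) ≤ q.a₀)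
    (huniq : ∀ (n : ℕ) (hnK : n < K) (ε₁ ε₀ : ℝ), 0 < ε₁ → ε₁ ≤ q.a₁ → 𝔠.B₃ * ε₁ ≤ ε₀ → ε₀ ≤ q.a₀ →
      ∀ V : GaugeField (F.P n) 0 (Matrix.specialUnitaryGroup (Fin 2) ℂ), PlaqSmall ε₁ V →
        ∀ U : GaugeField (F.P K) 0 (Matrix.specialUnitaryGroup (Fin 2) ℂ),
          (varProblem3 F n K hnK.le).OnMinimalOrbit (𝔠.B₃ * ε₁) V U → (varProblem3 F n K hnK.le).UniqueCriticalOrbit ε₀ V U)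
    (m : ℕ) (hm : m + 1 < K) :
    ∀ V : GaugeField (F.P K) (K - m) (Matrix.specialUnitaryGroup (Fin 2) ℂ),
      PlaqSmall (eps1Of (T3Scales F γ hγ (hγ1.trans (sq_min_one_le _ 𝔠.gamma0_pos)) K) 𝔠.lane.carrier (K - m)) V →
      PlaqSmall (eps1Of (T3Scales F γ hγ (hγ1.trans (sq_min_one_le _ 𝔠.gamma0_pos)) K) 𝔠.lane.carrier (K - (m + 1)))
        (Averaging.iter (fun i => BlockAveraging.blockAvg (P := F.P K) (j := i) ℰp) (K - (m + 1)) (ukAll q.X.Uk (K - m) V)) →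
      ∃ w : GaugeTransf (F.P K) 0 (Matrix.specialUnitaryGroup (Fin 2) ℂ),
        ukAll q.X.Uk (K - m) V =
          gaugeAct w (ukAll q.X.Uk (K - (m + 1)) (Averaging.iter (fun i => BlockAveraging.blockAvg (P := F.P K) (j := i) ℰp) (K - (m + 1)) (ukAll q.X.Uk (K - m) V))) := by
  intro V hV hU₀
  obtain ⟨w, -, hw⟩ := q.sameOrbit_ukAll_iterAvg_aux ha₁ ha₀L huniq m hm V hV hU₀
  exact ⟨w, hw⟩

/-- ★★ **PRINT'S COMPOSITION OF MINIMISERS MODULO GAUGE, levels form**: for `1 ≤ k`, `k + 1 ≤ K`, `V` in the level-`(k+1)` (4)-window with `U₀ := (blockAvg ℰp)^k U_{k+1}(V)` in the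
level-`k` (4)-window, `U_{k+1}(V) = U_k(U₀)^w` for some gauge transformation `w` of the finest lattice — [Balaban1985UV3] p.268 «If we substitute it [V^{(k)}] in U_k in place of V_k, we
get the configuration U_{k+1}» for the record's selections (here `V^{(k)} = U₀` by the constraint (42)), from r1 + r1′.
[cite: Balaban1985UV3, p.268 L13–16 + (42) p.266; Balaban1985Variational, Thm 1 (8) p.279 + (181) p.307] -/
theorem exists_ukAll_succ_eq_gaugeAct_ukAll_iterAvg (ha₁ : ∀ i, θBal F.L γ 𝔠.b₀ 𝔠.p₀ i ≤ q.a₁)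
    (ha₀L : ∀ i, (F.L : ℝ) ^ 3 * (𝔠.B₃ * θBal F.L γ 𝔠.b₀ 𝔠.p₀ i) ≤ q.a₀)
    (huniq : ∀ (n : ℕ) (hnK : n < K) (ε₁ ε₀ : ℝ), 0 < ε₁ → ε₁ ≤ q.a₁ → 𝔠.B₃ * ε₁ ≤ ε₀ → ε₀ ≤ q.a₀ →
      ∀ V : GaugeField (F.P n) 0 (Matrix.specialUnitaryGroup (Fin 2) ℂ), PlaqSmall ε₁ V →
        ∀ U : GaugeField (F.P K) 0 (Matrix.specialUnitaryGroup (Fin 2) ℂ),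
          (varProblem3 F n K hnK.le).OnMinimalOrbit (𝔠.B₃ * ε₁) V U → (varProblem3 F n K hnK.le).UniqueCriticalOrbit ε₀ V U)
    (k : ℕ) (hk1 : 1 ≤ k) (hk : k + 1 ≤ K) :
    ∀ V : GaugeField (F.P K) (k + 1) (Matrix.specialUnitaryGroup (Fin 2) ℂ),
      PlaqSmall (eps1Of (T3Scales F γ hγ (hγ1.trans (sq_min_one_le _ 𝔠.gamma0_pos)) K) 𝔠.lane.carrier (k + 1)) V →
      PlaqSmall (eps1Of (T3Scales F γ hγ (hγ1.trans (sq_min_one_le _ 𝔠.gamma0_pos)) K) 𝔠.lane.carrier k)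
        (Averaging.iter (fun i => BlockAveraging.blockAvg (P := F.P K) (j := i) ℰp) k (ukAll q.X.Uk (k + 1) V)) →
      ∃ w : GaugeTransf (F.P K) 0 (Matrix.specialUnitaryGroup (Fin 2) ℂ),
        ukAll q.X.Uk (k + 1) V = gaugeAct w (ukAll q.X.Uk k (Averaging.iter (fun i => BlockAveraging.blockAvg (P := F.P K) (j := i) ℰp) k (ukAll q.X.Uk (k + 1) V))) := by
  have h := q.exists_ukAll_eq_gaugeAct_ukAll_iterAvg_aux ha₁ ha₀L huniq (K - (k + 1)) (by omega)
  have e1 : K - (K - (k + 1)) = k + 1 := Nat.sub_sub_self hk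
  have e2 : K - (K - (k + 1) + 1) = k := by omega
  rw [e2, e1] at h
  exact h

/-! ## §3 The deep fibre point lies in print's family one level down -/

/-- ★★★ **THE DEEP FIBRE POINT OF (L1) LIES IN PRINT'S FAMILY `loPrintAC` ONE LEVEL DOWN** — for `V ∈ loPrintAC (k+1)` ((4)-window ∧ «|U_{k+1}(V)(∂p) − 1| < ε₁(k+1)L^{−2(k+1)}», print's
`χ_{k+1}` of (47)) and `U₀ := (blockAvg ℰp)^k U_{k+1}(V)` in the level-`k` (4)-window (the conjunct `χB_k(triv′)(U₀) ≠ 0` of ✓`deepFibrePoint_of_rows`), `U₀ ∈ loPrintAC k`: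
`|U_k(U₀)(∂p) − 1| = |U_{k+1}(V)(∂p) − 1|` (§2, plaquette variables are class functions ✓`plaqSmall_gaugeAct_iff'`) `< ε₁(k+1)L^{−2(k+1)} ≤ ε₁(k)L^{−2k}` (§0).  This is the extra conjunct the
(E2) re-cut «`χB_k(triv′) :=` print's χ_k^{min} (both windows)» demands of the deep fibre point — from rows r1 + r1′ (`huniq`) + the γ-thresholds `ha₁`, `ha₀L`, NO new estimate; `k = 0` is
`U_0 = id`. [cite: Balaban1985UV3, (47) p.267 + p.268 L13–16; Balaban1985Variational, Thm 1 (8) p.279] -/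
theorem iterAvg_ukAll_mem_loPrintAC (ha₁ : ∀ i, θBal F.L γ 𝔠.b₀ 𝔠.p₀ i ≤ q.a₁)
    (ha₀L : ∀ i, (F.L : ℝ) ^ 3 * (𝔠.B₃ * θBal F.L γ 𝔠.b₀ 𝔠.p₀ i) ≤ q.a₀)
    (huniq : ∀ (n : ℕ) (hnK : n < K) (ε₁ ε₀ : ℝ), 0 < ε₁ → ε₁ ≤ q.a₁ → 𝔠.B₃ * ε₁ ≤ ε₀ → ε₀ ≤ q.a₀ →
      ∀ V : GaugeField (F.P n) 0 (Matrix.specialUnitaryGroup (Fin 2) ℂ), PlaqSmall ε₁ V →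
        ∀ U : GaugeField (F.P K) 0 (Matrix.specialUnitaryGroup (Fin 2) ℂ),
          (varProblem3 F n K hnK.le).OnMinimalOrbit (𝔠.B₃ * ε₁) V U → (varProblem3 F n K hnK.le).UniqueCriticalOrbit ε₀ V U)
    (k : ℕ) (hk : k + 1 ≤ K) (V : GaugeField (F.P K) (k + 1) (Matrix.specialUnitaryGroup (Fin 2) ℂ))
    (hV : V ∈ PinnedStep.loPrintAC 𝔠.lane q.X (k + 1))
    (hU₀ : PlaqSmall (eps1Of (T3Scales F γ hγ (hγ1.trans (sq_min_one_le _ 𝔠.gamma0_pos)) K) 𝔠.lane.carrier k)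
      (Averaging.iter (fun i => BlockAveraging.blockAvg (P := F.P K) (j := i) ℰp) k (ukAll q.X.Uk (k + 1) V))) :
    Averaging.iter (fun i => BlockAveraging.blockAvg (P := F.P K) (j := i) ℰp) k (ukAll q.X.Uk (k + 1) V) ∈ PinnedStep.loPrintAC 𝔠.lane q.X k := by
  obtain ⟨hVw, hVc⟩ := (PinnedStep.mem_loPrintAC_iff 𝔠.lane q.X (k + 1) V).mp hV
  refine (PinnedStep.mem_loPrintAC_iff 𝔠.lane q.X k _).mpr ⟨hU₀, ?_⟩
  -- the threshold one level down: `ε₁(k+1)·L^{−2(k+1)} ≤ ε₁(k)·L^{−2k}`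
  have hL1 : 1 ≤ F.L := by have := F.hL.2; omega
  have hγ1' : γ ≤ 1 := hγ1.trans (sq_min_one_le _ 𝔠.gamma0_pos)
  have heps1 : eps1Of (T3Scales F γ hγ (hγ1.trans (sq_min_one_le _ 𝔠.gamma0_pos)) K) 𝔠.lane.carrier (k + 1) = θBal F.L γ 𝔠.b₀ 𝔠.p₀ (K - (k + 1)) :=
    q.eps1_eq (k + 1) hk
  have heps0 : eps1Of (T3Scales F γ hγ (hγ1.trans (sq_min_one_le _ 𝔠.gamma0_pos)) K) 𝔠.lane.carrier k = θBal F.L γ 𝔠.b₀ 𝔠.p₀ (K - k) :=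
    q.eps1_eq k (by omega)
  have hthr : 1 * eps1Of (T3Scales F γ hγ (hγ1.trans (sq_min_one_le _ 𝔠.gamma0_pos)) K) 𝔠.lane.carrier (k + 1) * ((F.L : ℝ)⁻¹) ^ (2 * (k + 1)) ≤
      1 * eps1Of (T3Scales F γ hγ (hγ1.trans (sq_min_one_le _ 𝔠.gamma0_pos)) K) 𝔠.lane.carrier k * ((F.L : ℝ)⁻¹) ^ (2 * k) := by
    have hst := AlphaInputsT3AC.θBal_mul_inv_sq_le_succ hL1 hγ hγ1' 𝔠.b₀_pos 𝔠.p₀_pos.le (K - (k + 1))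
    rw [show K - (k + 1) + 1 = K - k by omega, ← heps1, ← heps0] at hst
    have hx : 0 ≤ ((F.L : ℝ)⁻¹) ^ (2 * k) := pow_nonneg (inv_nonneg.mpr (Nat.cast_nonneg _)) _
    calc 1 * eps1Of (T3Scales F γ hγ (hγ1.trans (sq_min_one_le _ 𝔠.gamma0_pos)) K) 𝔠.lane.carrier (k + 1) * ((F.L : ℝ)⁻¹) ^ (2 * (k + 1))
        = 1 * (eps1Of (T3Scales F γ hγ (hγ1.trans (sq_min_one_le _ 𝔠.gamma0_pos)) K) 𝔠.lane.carrier (k + 1) * ((F.L : ℝ)⁻¹) ^ 2) * ((F.L : ℝ)⁻¹) ^ (2 * k) := by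
          ring
      _ ≤ 1 * eps1Of (T3Scales F γ hγ (hγ1.trans (sq_min_one_le _ 𝔠.gamma0_pos)) K) 𝔠.lane.carrier k * ((F.L : ℝ)⁻¹) ^ (2 * k) :=
          mul_le_mul_of_nonneg_right (mul_le_mul_of_nonneg_left hst zero_le_one) hx
  rcases Nat.eq_zero_or_pos k with rfl | hk1
  · -- `U_0 = id`, `U₀ = U_1(V)`
    exact plaqSmall_of_le hthr hVc
  · obtain ⟨w, hw⟩ := q.exists_ukAll_succ_eq_gaugeAct_ukAll_iterAvg ha₁ ha₀L huniq k hk1 hk V hVw hU₀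
    rw [hw] at hVc
    exact plaqSmall_of_le hthr ((B12GaugeOrbits021.plaqSmall_gaugeAct_iff' _ w _).mp hVc)

end AlphaInputsT3AC.PkgCoreRows

end Summit.QuantumFields.YangMills.Theorems

end
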